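import Mathlib.Analysis.Complex.Basic
import Mathlib.Algebra.BigOperators.Intervals
import Mathlib.Algebra.BigOperators.Fin
import Literature.MathematicalPhysics.QuantumFieldTheory.CubicalCochains
import HarnessLib

/-!
# Bloch-periodic cochains on `ℤ^d`: the degree-one Poincaré lemma, quasi-periodic primitives, and the maximum principle for Bloch-periodic discrete-harmonic functions

Model-free lattice facts (everything `[folklore]`, everything proved; companion of
`CubicalCochains.lean`, whose cubical coboundaries `LatticeForm.d₀`, `LatticeForm.d₁` on
`Site d = ℤ^d` are reused). Written for the β sub-cell of the Bałaban reconstruction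
(`HOME/BETA/TRANSFER.md` v8 §23: the elementary, cohomological half of the fibre/torus uniqueness
argument behind the residual `(Liouville-KKT)_k` of the `[H-germ′]` certificate — readings A/B there),
but nothing here refers to gauge fields, averaging operators or any manuscript: these are the three
textbook inputs such an argument consumes, in kernel form.

## Contents

* **A two-sided antiderivative on `ℤ`** (`zsum`, `zsum_succ_sub`, uniqueness `eq_zsum_of_sub_eq`,
  telescoping `zsum_sub_succ_eq`) and line integrals along an axis (`sub_eq_zsum_d₀`,
  `sub_eq_sum_d₀`).
* **Poincaré lemma in degree one on `ℤ^d`, without support conditions** (`prim`, `d₀_prim`,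
  `exists_d₀_eq_of_d₁_eq_zero`): a closed `1`-cochain (`d₁ θ = 0`) is the coboundary of its
  staircase primitive; `H⁰`: `eq_of_d₀_eq_zero` (vanishing coboundary ⇒ constant), `primitive_unique`.
  (`CubicalCochains.lean` has the compactly supported `H²` version and an axis-invariant `H¹` lemma;
  the plain `H¹(ℤ^d) = 0` was missing.)
* **Bloch (quasi-)periodicity** `IsBloch N χ u : u (x + N•a) = χ a • u x` with respect to the
  sublattice `N•ℤ^d` (for `χ ≡ 1`: `N`-periodicity, i.e. fields on the discrete torus `(ℤ/Nℤ)^d`; for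
  a unitary character: Bloch waves of one quasimomentum), the Bloch `defect` of a primitive, its
  constancy (`defect_const`) and **cocycle identity** (`defect_cocycle`), and the two `H¹` statements:
  - `exists_isBloch_primitive` — **twisted `H¹` vanishes**: a closed `χ`-Bloch `1`-cochain with
    `χ a₀ ≠ 1` for some `a₀` has a `χ`-Bloch primitive (over any field);
  - `exists_const_add_d₀_of_periodic` — **untwisted `H¹` of the discrete torus is spanned by the
    constant `1`-cochains**: an `N`-periodic closed `1`-cochain is `c + d₀ μ` with `c` CONSTANT (the
    cycle averages `c i = N⁻¹ • ∑_{t<N} θ(t•eᵢ; i)`) and `μ` `N`-PERIODIC (needs `N ≠ 0` in the field).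
* **Maximum principle for the nearest-neighbour Laplacian** `lap` (`(Δu)(x) = ∑ᵢ (u(x+eᵢ)+u(x-eᵢ)-2u(x))`):
  `eq_of_norm_le_of_sum_eq_card_smul` (equality case of the averaged triangle inequality in `ℂ`),
  `forall_of_step` (connectedness of `ℤ^d` by unit steps), and
  - `IsBloch.apply_eq_of_lap_eq_zero` — a `χ`-Bloch discrete-harmonic `u : ℤ^d → ℂ` with UNITARY `χ`
    is constant (its modulus is periodic, hence attains its maximum; propagate);
  - `IsBloch.eq_zero_of_lap_eq_zero` — … and vanishes if `χ a₀ ≠ 1` for some `a₀` (no Bloch waves of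
    non-zero quasimomentum in `ker Δ`);
  - `apply_eq_of_periodic_of_lap_eq_zero` — **Liouville for periodic discrete-harmonic functions**.
* (v1.1) **Torus form** `exists_const_add_td₀`: the same `H¹` statement for `1`-cochains on the discrete torus type
  `TorusSite d N = Fin d → ZMod N` (`td₀`, `repZ`, `proj_add_e`, `exists_eq_add_zsmul_of_proj_eq`), closedness stated by
  the explicit plaquette formula (= `LatticeForm.td₁ θ = 0` of `AbelianTorusCochains.lean`, not imported here) — the
  concrete instance of hypothesis (Hdg) of `Beta.TorusKKTUniqueness.torus_uniqueness`; (v1.2) `exists_const_add_grad_prod`,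
  the same for uncurried direction-first cochains `Fin d × (Fin d → ZMod N) → V` (the indexing of `Beta.OneBlockTorusKKT.Hdg`).

## Context (not used in any proof)

These are the finite-dimensional ("one real fibre at a time") ingredients of Floquet–Bloch arguments for
`ℤ^d`-periodic lattice systems; the complementary Floquet step — «a periodic equation has a non-zero
polynomially growing solution iff its real Fermi surface is non-empty» — is Kuchment–Pinchover,
Trans. AMS 359 (2007) Thm 4.3 p. 5796 (graphs/difference operators: Thm 7.1 pp. 5807–5808)
[KuchmentPinchover2007], restated in Kha–Kuchment, LNM 2245 (2021) Thm 1.11 [KhaKuchment2021]. The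
continuum counterparts of the present file are classical: `H¹` of the torus with coefficients in a flat
line bundle (vanishing for a non-trivial character; spanned by `dx₁,…,dx_d` for the trivial one) and the
maximum principle / Liouville property of harmonic functions.
-/

open Finset Function

namespace Literature.MathematicalPhysics.QuantumFieldTheory

namespace LatticeForm

open Literature.Probability.LatticeModels (Site)

variable {d : ℕ} {A : Type*} [AddCommGroup A]

/-! ### A two-sided discrete antiderivative on `ℤ` -/

/-- `zsum F n = ∑_{0 ≤ k < n} F k` for `n ≥ 0` and `= -∑_{n ≤ k < 0} F k` for `n < 0`: the
two-sided antiderivative of `F : ℤ → A` normalised by `zsum F 0 = 0`. [folklore] -/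
def zsum (F : ℤ → A) (n : ℤ) : A :=
  (∑ k ∈ Finset.range n.toNat, F k) - ∑ k ∈ Finset.range (-n).toNat, F (-((k : ℤ) + 1))

/-- `zsum F 0 = 0`. [folklore] -/
@[simp] theorem zsum_zero (F : ℤ → A) : zsum F 0 = 0 := by
  simp [zsum]

/-- The defining difference equation: `zsum F (n + 1) - zsum F n = F n` for every `n : ℤ`. [folklore] -/
theorem zsum_succ_sub (F : ℤ → A) (n : ℤ) : zsum F (n + 1) - zsum F n = F n := by
  unfold zsum
  rcases le_or_gt 0 n with hn | hn
  · have h1 : (n + 1).toNat = n.toNat + 1 := by omega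
    have h2 : (-(n + 1)).toNat = 0 := by omega
    have h3 : (-n).toNat = 0 := by omega
    have h4 : ((n.toNat : ℕ) : ℤ) = n := by omega
    rw [h1, h2, h3, Finset.sum_range_succ, h4]
    simp
  · have h1 : (n + 1).toNat = 0 := by omega
    have h2 : n.toNat = 0 := by omega
    have h3 : (-n).toNat = (-(n + 1)).toNat + 1 := by omega
    have h4 : (((-(n + 1)).toNat : ℕ) : ℤ) = -(n + 1) := by omega
    rw [h1, h2, h3, Finset.sum_range_succ, h4]
    have h5 : -(-(n + 1) + 1) = n := by ring
    rw [h5]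
    simp only [Finset.range_zero, Finset.sum_empty, zero_sub, neg_add_rev]
    abel

/-- Uniqueness of the antiderivative: any `H` with `H 0 = 0` and `H (n+1) - H n = F n` is `zsum F`. [folklore] -/
theorem eq_zsum_of_sub_eq {F : ℤ → A} {H : ℤ → A} (h0 : H 0 = 0)
    (hstep : ∀ n : ℤ, H (n + 1) - H n = F n) : ∀ n, H n = zsum F n := by
  intro n
  induction n using Int.induction_on with
  | zero => simp [h0]
  | succ k ih =>
    have h1 := hstep k
    have h2 := zsum_succ_sub F k
    rw [sub_eq_iff_eq_add] at h1 h2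
    rw [h1, h2, ih]
  | pred k ih =>
    have h1 := hstep (-(k : ℤ) - 1)
    have h2 := zsum_succ_sub F (-(k : ℤ) - 1)
    rw [show -(k : ℤ) - 1 + 1 = -(k : ℤ) by ring] at h1 h2
    rw [sub_eq_iff_eq_add'] at h1 h2
    rw [h1, h2] at ih
    exact add_right_cancel ih

/-- `zsum` is additive in the integrand: `zsum (F - G) = zsum F - zsum G`. [folklore] -/
theorem zsum_sub (F G : ℤ → A) (n : ℤ) : zsum (F - G) n = zsum F n - zsum G n := by
  simp only [zsum, Pi.sub_apply, Finset.sum_sub_distrib]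
  abel

/-- **Discrete fundamental theorem of calculus on `ℤ`**: the antiderivative of a forward
difference telescopes, `zsum (fun t => G (t+1) - G t) n = G n - G 0`, for every `n : ℤ`. [folklore] -/
theorem zsum_sub_succ_eq (G : ℤ → A) (n : ℤ) :
    zsum (fun t => G (t + 1) - G t) n = G n - G 0 := by
  symm
  apply eq_zsum_of_sub_eq (H := fun m => G m - G 0)
  · simp
  · intro m; abel

/-! ### The degree-one Poincaré lemma on `ℤ^d` (no support condition) -/

/-- Truncation of a lattice point: keep the coordinates of index `< m`, set the others to `0`
(the corners `(x₀, …, x_{m-1}, 0, …, 0)` of the staircase path from `0` to `x`). [folklore] -/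
def trunc (m : ℕ) (x : Site d) : Site d := fun j => if (j : ℕ) < m then x j else 0

/-- Kept coordinates. [folklore] -/
@[simp] theorem trunc_apply_of_lt {m : ℕ} {x : Site d} {j : Fin d} (h : (j : ℕ) < m) :
    trunc m x j = x j := by simp [trunc, h]

/-- Zeroed coordinates. [folklore] -/
@[simp] theorem trunc_apply_of_le {m : ℕ} {x : Site d} {j : Fin d} (h : m ≤ (j : ℕ)) :
    trunc m x j = 0 := by simp [trunc, Nat.not_lt.2 h]

/-- Beyond the dimension the truncation is the identity. [folklore] -/
theorem trunc_of_le {m : ℕ} (h : d ≤ m) (x : Site d) : trunc m x = x := by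
  funext j; exact trunc_apply_of_lt (lt_of_lt_of_le j.isLt h)

/-- `trunc 0 = 0`. [folklore] -/
@[simp] theorem trunc_zero (x : Site d) : trunc 0 x = 0 := by
  funext j; simp [trunc]

/-- `trunc (i+1) x` is `trunc i x` with the `i`-th coordinate set to `x i`. [folklore] -/
theorem trunc_succ (i : Fin d) (x : Site d) :
    trunc ((i : ℕ) + 1) x = update (trunc i x) i (x i) := by
  funext j
  by_cases hj : j = i
  · subst hj; simp [trunc]
  · have hne : (j : ℕ) ≠ (i : ℕ) := fun h => hj (Fin.ext h)
    rw [update_of_ne hj]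
    by_cases hlt : (j : ℕ) < i
    · simp [trunc, hlt, Nat.lt_succ_of_lt hlt]
    · have h1 : ¬ (j : ℕ) < (i : ℕ) + 1 := by omega
      simp [trunc, hlt, h1]

/-- Truncation below `i` does not see a translation along `eⱼ` for `j ≥ i`. [folklore] -/
theorem trunc_add_e_of_le {i : ℕ} {j : Fin d} (h : i ≤ (j : ℕ)) (x : Site d) :
    trunc i (x + e j) = trunc i x := by
  funext m
  by_cases hm : (m : ℕ) < i
  · have hmj : m ≠ j := by intro hmj; subst hmj; omega
    simp [trunc, hm, Pi.single_eq_of_ne hmj]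
  · simp [trunc, hm]

/-- Truncation below `i` commutes with a translation along `eⱼ` for `j < i`. [folklore] -/
theorem trunc_add_e_of_lt {i : ℕ} {j : Fin d} (h : (j : ℕ) < i) (x : Site d) :
    trunc i (x + e j) = trunc i x + e j := by
  funext m
  by_cases hm : (m : ℕ) < i
  · simp [trunc, hm]
  · have hmj : m ≠ j := by intro hmj; subst hmj; omega
    simp [trunc, hm, Pi.single_eq_of_ne hmj]

/-- The `i`-th coordinate of `trunc i x` vanishes, so updating it to `0` does nothing. [folklore] -/
theorem update_trunc_zero (i : Fin d) (x : Site d) : update (trunc i x) i 0 = trunc i x := by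
  funext m
  by_cases hm : m = i
  · subst hm; simp [trunc]
  · rw [update_of_ne hm]

/-- **The staircase primitive** of a `1`-cochain: integrate `θ(·; i)` along the axis `i` on the
staircase path `0 → (x₀,0,…) → (x₀,x₁,0,…) → ⋯ → x`. [folklore] -/
def prim (θ : Site d → Fin d → A) (x : Site d) : A :=
  ∑ i : Fin d, zsum (fun t => θ (update (trunc i x) i t) i) (x i)

/-- The increment of the `i`-th staircase term across `eⱼ`: zero for `i < j`, the integrand for
`i = j`, and — by closedness `d₁ θ = 0` — a transverse difference for `i > j`. [folklore] -/
theorem prim_term_add_e (θ : Site d → Fin d → A) (hcl : d₁ θ = 0) (x : Site d) (i j : Fin d) :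
    zsum (fun t => θ (update (trunc i (x + e j)) i t) i) ((x + e j) i)
      - zsum (fun t => θ (update (trunc i x) i t) i) (x i)
      = if (i : ℕ) < j then 0
        else if i = j then θ (trunc ((j : ℕ) + 1) x) j
        else θ (trunc ((i : ℕ) + 1) x) j - θ (trunc i x) j := by
  by_cases hij : (i : ℕ) < j
  · -- `i < j`: the `i`-th term does not change
    have hne : i ≠ j := by intro h; subst h; omega
    rw [if_pos hij, trunc_add_e_of_le hij.le, add_single_apply_of_ne x hne, sub_self]
  rw [if_neg hij]
  by_cases heq : i = j
  · subst heq
    rw [if_pos rfl, trunc_add_e_of_le le_rfl, add_single_apply_self, zsum_succ_sub, trunc_succ]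
  · rw [if_neg heq]
    have hji : (j : ℕ) < i := by
      have : (i : ℕ) ≠ j := fun h => heq (Fin.ext h)
      omega
    rw [trunc_add_e_of_lt hji, add_single_apply_of_ne x heq, ← zsum_sub]
    -- closedness turns the `eⱼ`-difference of `θ(·;i)` into the `eᵢ`-difference of `θ(·;j)`
    have key : ((fun t => θ (update (trunc (↑i) x + e j) i t) i)
          - fun t => θ (update (trunc (↑i) x) i t) i)
        = fun t => θ (update (trunc (↑i) x) i (t + 1)) j - θ (update (trunc (↑i) x) i t) j := by
      funext t
      have h0 := congrFun (congrFun (congrFun hcl (update (trunc (↑i) x) i t)) j) i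
      simp only [d₁, Pi.zero_apply] at h0
      rw [update_add_single_eq] at h0
      simp only [Pi.sub_apply]
      rw [update_add_single_of_ne _ (Ne.symm heq)]
      rw [← sub_eq_zero]
      have : θ (update (trunc (↑i) x) i t + e j) i - θ (update (trunc (↑i) x) i t) i -
          (θ (update (trunc (↑i) x) i (t + 1)) j - θ (update (trunc (↑i) x) i t) j)
          = θ (update (trunc (↑i) x) i t) j + θ (update (trunc (↑i) x) i t + e j) i -
            θ (update (trunc (↑i) x) i (t + 1)) j - θ (update (trunc (↑i) x) i t) i := by abel
      rw [this, h0]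
    rw [key]
    have htel := zsum_sub_succ_eq (fun t => θ (update (trunc (↑i) x) i t) j) (x i)
    rw [htel, ← trunc_succ, update_trunc_zero]

/-- Telescoping over the indices above `j`: `∑_{j < n < d} (a (n+1) - a n) = a d - a (j+1)`, written
as a sum over `Fin d`. [folklore] -/
theorem sum_fin_ite_telescope (a : ℕ → A) (c : A) (j : Fin d) :
    ∑ i : Fin d, (if (i : ℕ) < j then 0 else if i = j then c else a ((i : ℕ) + 1) - a i)
      = c + (a d - a ((j : ℕ) + 1)) := by
  set g : ℕ → A := fun n => if n < j then 0 else if n = j then c else a (n + 1) - a n with hg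
  have hterm : ∀ i : Fin d,
      (if (i : ℕ) < j then 0 else if i = j then c else a ((i : ℕ) + 1) - a i) = g i := by
    intro i
    simp only [hg, Fin.ext_iff]
  rw [Finset.sum_congr rfl (fun i _ => hterm i), Fin.sum_univ_eq_sum_range (f := g) d]
  have hjd : (j : ℕ) < d := j.isLt
  rw [Finset.range_eq_Ico, ← Finset.sum_Ico_consecutive g (Nat.zero_le j) hjd.le,
    Finset.sum_eq_sum_Ico_succ_bot hjd]
  have h1 : ∑ n ∈ Finset.Ico 0 (j : ℕ), g n = 0 := by
    apply Finset.sum_eq_zero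
    intro n hn
    have : n < j := (Finset.mem_Ico.1 hn).2
    simp [hg, this]
  have h2 : g j = c := by simp [hg]
  have h3 : ∑ n ∈ Finset.Ico ((j : ℕ) + 1) d, g n = a d - a ((j : ℕ) + 1) := by
    rw [Finset.sum_Ico_eq_sum_range]
    have : ∀ k ∈ Finset.range (d - ((j : ℕ) + 1)),
        g ((j : ℕ) + 1 + k) = a ((j : ℕ) + 1 + (k + 1)) - a ((j : ℕ) + 1 + k) := by
      intro k _
      have hk1 : ¬ ((j : ℕ) + 1 + k < j) := by omega
      have hk2 : (j : ℕ) + 1 + k ≠ j := by omega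
      have hk3 : (j : ℕ) + 1 + k + 1 = (j : ℕ) + 1 + (k + 1) := by omega
      simp only [hg, hk1, hk2, if_false, hk3]
    rw [Finset.sum_congr rfl this, Finset.sum_range_sub (fun k => a ((j : ℕ) + 1 + k))]
    have : (j : ℕ) + 1 + (d - ((j : ℕ) + 1)) = d := by omega
    rw [this, add_zero]
  rw [h1, h2, h3, zero_add]

/-- **Poincaré lemma in degree one on `ℤ^d` (no support condition):** a closed `1`-cochain is the
coboundary of its staircase primitive, `d₁ θ = 0 → d₀ (prim θ) = θ`; i.e. `H¹(ℤ^d; A) = 0`.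
[folklore] -/
theorem d₀_prim (θ : Site d → Fin d → A) (hcl : d₁ θ = 0) : d₀ (prim θ) = θ := by
  funext x j
  simp only [d₀, prim]
  rw [← Finset.sum_sub_distrib, Finset.sum_congr rfl (fun i _ => prim_term_add_e θ hcl x i j),
    sum_fin_ite_telescope (fun n => θ (trunc n x) j) (θ (trunc ((j : ℕ) + 1) x) j) j]
  rw [trunc_of_le le_rfl]
  abel

/-- Every closed `1`-cochain on `ℤ^d` is exact. [folklore] -/
theorem exists_d₀_eq_of_d₁_eq_zero (θ : Site d → Fin d → A) (hcl : d₁ θ = 0) :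
    ∃ f : Site d → A, d₀ f = θ :=
  ⟨prim θ, d₀_prim θ hcl⟩

/-- `H⁰(ℤ^d)`: a `0`-cochain with vanishing coboundary is constant. [folklore] -/
theorem eq_of_d₀_eq_zero {f : Site d → A} (h : d₀ f = 0) (x y : Site d) : f x = f y := by
  have hstep : ∀ (ℓ : Fin d) (z : Site d), f (z + e ℓ) = f z := by
    intro ℓ z
    have := congrFun (congrFun h z) ℓ
    simpa [d₀, sub_eq_zero] using this
  -- `f (trunc m z) = f 0` for every `m`, hence `f z = f 0`
  have htr : ∀ (z : Site d) (m : ℕ), f (trunc m z) = f 0 := by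
    intro z m
    induction m with
    | zero => simp
    | succ m ih =>
      by_cases hm : m < d
      · have := trunc_succ ⟨m, hm⟩ z
        simp only at this
        rw [this, apply_update_eq_of_invariant (hstep ⟨m, hm⟩), ih]
      · rw [trunc_of_le (by omega), ← trunc_of_le (show d ≤ m by omega) z, ih]
  rw [← trunc_of_le le_rfl x, ← trunc_of_le le_rfl y, htr x d, htr y d]

/-- Primitives are unique up to an additive constant. [folklore] -/
theorem primitive_unique {f g : Site d → A} (h : d₀ f = d₀ g) (x : Site d) :
    f x - g x = f 0 - g 0 := by
  have : d₀ (f - g) = 0 := by rw [d₀_sub, h, sub_self]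
  exact eq_of_d₀_eq_zero this x 0

/-- `d₀` is additive: `d₀ (f + g) = d₀ f + d₀ g`. [folklore] -/
theorem d₀_add (f g : Site d → A) : d₀ (f + g) = d₀ f + d₀ g := by
  funext x i; simp only [d₀, Pi.add_apply]; abel

/-- Shifting a `0`-cochain by a constant does not change its coboundary. [folklore] -/
theorem d₀_sub_const (f : Site d → A) (s : A) : d₀ (fun x => f x - s) = d₀ f := by
  funext x i; simp only [d₀, sub_sub_sub_cancel_right]

/-- Line integrals along an axis: `f (x + n•eᵢ) - f x = zsum (t ↦ d₀ f (x + t•eᵢ) i) n`. [folklore] -/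
theorem sub_eq_zsum_d₀ (f : Site d → A) (x : Site d) (i : Fin d) (n : ℤ) :
    f (x + n • e i) - f x = zsum (fun t => d₀ f (x + t • e i) i) n := by
  apply eq_zsum_of_sub_eq (H := fun m => f (x + m • e i) - f x)
  · simp
  · intro m
    simp only [d₀, add_smul, one_smul, add_assoc]
    abel

/-- For `n = N ≥ 0` the line integral is a plain sum: `f (x + N•eᵢ) - f x = ∑_{t<N} d₀ f (x + t•eᵢ) i`.
[folklore] -/
theorem sub_eq_sum_d₀ (f : Site d → A) (x : Site d) (i : Fin d) (N : ℕ) :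
    f (x + (N : ℤ) • e i) - f x = ∑ t ∈ Finset.range N, d₀ f (x + (t : ℤ) • e i) i := by
  rw [sub_eq_zsum_d₀]
  simp [zsum]

/-! ### Bloch (quasi-)periodicity with respect to the sublattice `N•ℤ^d` -/

section Bloch

variable {R : Type*} [CommRing R] {M : Type*} [AddCommGroup M] [Module R M]

/-- `u` is `χ`-Bloch (quasi-periodic, Floquet) with respect to the sublattice `N•ℤ^d`:
`u (x + N•a) = χ a • u x` for all `x, a ∈ ℤ^d`. For `χ ≡ 1` this is plain `N`-periodicity; for a
unitary character `χ a = e^{ik·Na}` these are the Bloch waves of quasimomentum `k`. Works verbatim for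
cochains of any degree (`M` = values, or `Fin d → values`, …). [folklore] -/
def IsBloch (N : ℕ) (χ : Site d → R) (u : Site d → M) : Prop :=
  ∀ x a : Site d, u (x + (N : ℤ) • a) = χ a • u x

omit [Module R M] in
/-- `IsBloch N 1` is `N`-periodicity. [folklore] -/
theorem isBloch_one_iff {N : ℕ} {u : Site d → M} [Module R M] :
    IsBloch N (fun _ => (1 : R)) u ↔ ∀ x a : Site d, u (x + (N : ℤ) • a) = u x := by
  simp [IsBloch]

/-- The Bloch defect of a `0`-cochain `lam` in the direction `a`: `x ↦ lam (x + N•a) - χ a • lam x`.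
[folklore] -/
def defect (N : ℕ) (χ : Site d → R) (lam : Site d → M) (a x : Site d) : M :=
  lam (x + (N : ℤ) • a) - χ a • lam x

/-- If `d₀ lam` is `χ`-Bloch then every Bloch defect of `lam` has vanishing coboundary. [folklore] -/
theorem d₀_defect {N : ℕ} {χ : Site d → R} {lam : Site d → M} (hB : IsBloch N χ (d₀ lam))
    (a : Site d) : d₀ (defect N χ lam a) = 0 := by
  funext x i
  have h := congrFun (hB x a) i
  simp only [Pi.smul_apply, d₀] at h
  simp only [d₀, defect, Pi.zero_apply]
  rw [add_right_comm x (e i) ((N : ℤ) • a)]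
  have : lam (x + (N : ℤ) • a + e i) - χ a • lam (x + e i) - (lam (x + (N : ℤ) • a) - χ a • lam x)
      = (lam (x + (N : ℤ) • a + e i) - lam (x + (N : ℤ) • a)) - (χ a • lam (x + e i) - χ a • lam x) := by
    abel
  rw [this, h, smul_sub, sub_self]

/-- … hence every Bloch defect is CONSTANT on `ℤ^d`. [folklore] -/
theorem defect_const {N : ℕ} {χ : Site d → R} {lam : Site d → M} (hB : IsBloch N χ (d₀ lam))
    (a x y : Site d) : defect N χ lam a x = defect N χ lam a y :=
  eq_of_d₀_eq_zero (d₀_defect hB a) x y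

/-- The quasi-periodicity law of a primitive: `lam (x + N•a) = χ a • lam x + D a` with the constant
`D a = defect N χ lam a 0`. [folklore] -/
theorem apply_add_period {N : ℕ} {χ : Site d → R} {lam : Site d → M} (hB : IsBloch N χ (d₀ lam))
    (a x : Site d) : lam (x + (N : ℤ) • a) = χ a • lam x + defect N χ lam a 0 := by
  have := defect_const hB a x 0
  simp only [defect] at this
  rw [sub_eq_iff_eq_add'] at this
  rw [this]
  rfl

/-- **The cocycle identity** of the Bloch defects: `(1 - χ b) • D a = (1 - χ a) • D b`
(evaluate `lam (N•a + N•b)` in the two orders). [folklore] -/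
theorem defect_cocycle {N : ℕ} {χ : Site d → R} {lam : Site d → M} (hB : IsBloch N χ (d₀ lam))
    (a b : Site d) :
    (1 - χ b) • defect N χ lam a 0 = (1 - χ a) • defect N χ lam b 0 := by
  set D := fun c => defect N χ lam c 0 with hD
  have h1 := apply_add_period hB b ((N : ℤ) • a)
  have h2 := apply_add_period hB a ((N : ℤ) • b)
  have ha := apply_add_period hB a 0
  have hb := apply_add_period hB b 0
  rw [zero_add] at ha hb
  rw [ha] at h1
  rw [hb, add_comm ((N : ℤ) • b)] at h2
  rw [h1] at h2
  -- h2 : χ b • (χ a • lam 0 + D a) + D b = χ a • (χ b • lam 0 + D b) + D a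
  simp only [smul_add, smul_smul, mul_comm (χ b) (χ a), add_assoc] at h2
  have h3 := add_left_cancel h2
  -- h3 : χ b • D a + D b = χ a • D b + D a
  show (1 - χ b) • D a = (1 - χ a) • D b
  rw [sub_smul, one_smul, sub_smul, one_smul, sub_eq_sub_iff_add_eq_add, add_comm (D a),
    add_comm (D b)]
  exact h3.symm

/-- If `lam` is `χ`-Bloch then so is its coboundary `d₀ lam`. [folklore] -/
theorem IsBloch.d₀ {N : ℕ} {χ : Site d → R} {lam : Site d → M} (h : IsBloch N χ lam) :
    IsBloch N χ (d₀ lam) := by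
  intro x a
  funext i
  simp only [LatticeForm.d₀, Pi.smul_apply]
  rw [add_right_comm x ((N : ℤ) • a) (e i), h (x + e i) a, h x a, smul_sub]

end Bloch

section Field

variable {𝕜 : Type*} [Field 𝕜] {V : Type*} [AddCommGroup V] [Module 𝕜 V]

/-- **Twisted `H¹` vanishes:** if a closed `1`-cochain `θ` is `χ`-Bloch for a character with
`χ a₀ ≠ 1` for some `a₀` (a non-trivial quasimomentum), then `θ = d₀ lam` with `lam` `χ`-Bloch as well
— shift any primitive by the constant `(1 - χ a₀)⁻¹ • D a₀`. (The cellular cohomology of the torus with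
coefficients in a non-trivial flat line bundle vanishes.) [folklore] -/
theorem exists_isBloch_primitive {N : ℕ} {χ : Site d → 𝕜} {θ : Site d → Fin d → V}
    (hθ : IsBloch N χ θ) (hcl : d₁ θ = 0) {a₀ : Site d} (h₀ : χ a₀ ≠ 1) :
    ∃ lam : Site d → V, IsBloch N χ lam ∧ d₀ lam = θ := by
  obtain ⟨lam, hlam⟩ := exists_d₀_eq_of_d₁_eq_zero θ hcl
  have hB : IsBloch N χ (d₀ lam) := by rw [hlam]; exact hθ
  set D := fun c => defect N χ lam c 0 with hD
  have h1 : (1 : 𝕜) - χ a₀ ≠ 0 := sub_ne_zero.2 (Ne.symm h₀)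
  set s : V := (1 - χ a₀)⁻¹ • D a₀ with hs
  refine ⟨fun x => lam x - s, ?_, ?_⟩
  · intro x a
    have key := apply_add_period hB a x
    have cyc := defect_cocycle hB a a₀
    -- cyc : (1 - χ a₀) • D a = (1 - χ a) • D a₀
    have hDa : D a = (1 - χ a) • s := by
      rw [hs, smul_smul, mul_comm, ← smul_smul]
      show D a = (1 - χ a₀)⁻¹ • ((1 - χ a) • D a₀)
      rw [← cyc, smul_smul, inv_mul_cancel₀ h1, one_smul]
    show lam (x + (N : ℤ) • a) - s = χ a • (lam x - s)
    rw [key, smul_sub]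
    change χ a • lam x + D a - s = χ a • lam x - χ a • s
    rw [hDa, sub_smul, one_smul]
    abel
  · rw [d₀_sub_const, hlam]

/-- The additive period map of a primitive of an `N`-PERIODIC closed `1`-cochain:
`a ↦ lam (N•a) - lam 0`. [folklore] -/
def periodHom {N : ℕ} {lam : Site d → V}
    (hB : IsBloch N (fun _ => (1 : 𝕜)) (d₀ lam)) : Site d →+ V where
  toFun a := defect N (fun _ => (1 : 𝕜)) lam a 0
  map_zero' := by simp [defect]
  map_add' a b := by
    have h := apply_add_period hB b ((N : ℤ) • a)
    simp only [defect, one_smul, zero_add] at h ⊢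
    rw [smul_add, h]
    abel

omit [Module 𝕜 V] in
/-- A lattice vector is the integer combination of the unit vectors: `a = ∑ i, a i • eᵢ`. [folklore] -/
theorem eq_sum_zsmul_e (a : Site d) : a = ∑ i : Fin d, a i • (e i : Site d) := by
  conv_lhs => rw [← Finset.univ_sum_single a]
  refine Finset.sum_congr rfl (fun i _ => ?_)
  funext j
  by_cases hj : j = i
  · subst hj; simp
  · simp [Pi.single_eq_of_ne hj]

/-- **Untwisted `H¹` of the discrete torus:** an `N`-periodic closed `1`-cochain on `ℤ^d` (equivalently
a closed `1`-cochain on the discrete torus `(ℤ/Nℤ)^d`) is a CONSTANT `1`-cochain plus the coboundary of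
an `N`-PERIODIC `0`-cochain, `θ = c + d₀ μ`; the constant is the cycle average
`c i = N⁻¹ • ∑_{t<N} θ (t•eᵢ; i)` (the holonomy of `θ` along the `i`-th fundamental cycle, divided by
its length). Requires `N ≠ 0` in the field. [folklore] -/
theorem exists_const_add_d₀_of_periodic {N : ℕ} (hN : (N : 𝕜) ≠ 0) {θ : Site d → Fin d → V}
    (hθ : ∀ x a : Site d, θ (x + (N : ℤ) • a) = θ x) (hcl : d₁ θ = 0) :
    ∃ (c : Fin d → V) (μ : Site d → V), (∀ x a : Site d, μ (x + (N : ℤ) • a) = μ x) ∧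
      θ = (fun _ => c) + d₀ μ ∧
      ∀ i, c i = (N : 𝕜)⁻¹ • ∑ t ∈ Finset.range N, θ ((t : ℤ) • e i) i := by
  obtain ⟨lam, hlam⟩ := exists_d₀_eq_of_d₁_eq_zero θ hcl
  have hB : IsBloch N (fun _ => (1 : 𝕜)) (d₀ lam) := by
    intro x a; rw [one_smul, hlam]; exact hθ x a
  set D : Site d →+ V := periodHom hB with hD
  have hDapply : ∀ a, D a = lam ((N : ℤ) • a) - lam 0 := by
    intro a; simp [hD, periodHom, defect]
  have key : ∀ a x, lam (x + (N : ℤ) • a) = lam x + D a := by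
    intro a x
    have := apply_add_period hB a x
    rw [one_smul] at this
    exact this
  -- `D a = ∑ i, a i • D eᵢ`
  have hDsum : ∀ a : Site d, D a = ∑ i : Fin d, (a i : 𝕜) • D (e i) := by
    intro a
    conv_lhs => rw [eq_sum_zsmul_e a, map_sum]
    refine Finset.sum_congr rfl (fun i _ => ?_)
    rw [map_zsmul, Int.cast_smul_eq_zsmul]
  -- the linear part
  set ℓ : Site d → V := fun x => ∑ i : Fin d, ((x i : 𝕜) * (N : 𝕜)⁻¹) • D (e i) with hℓ
  have hℓper : ∀ x a : Site d, ℓ (x + (N : ℤ) • a) - ℓ x = D a := by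
    intro x a
    rw [hDsum a, hℓ]
    simp only [← Finset.sum_sub_distrib, ← sub_smul]
    refine Finset.sum_congr rfl (fun i _ => ?_)
    congr 1
    simp only [Pi.add_apply, Pi.smul_apply, smul_eq_mul, Int.cast_add, Int.cast_mul,
      Int.cast_natCast]
    field_simp
    ring
  have hℓd : ∀ (x : Site d) (i : Fin d), d₀ ℓ x i = (N : 𝕜)⁻¹ • D (e i) := by
    intro x i
    simp only [d₀, hℓ, ← Finset.sum_sub_distrib, ← sub_smul]
    rw [Finset.sum_eq_single i]
    · simp only [Pi.add_apply, Pi.single_eq_same, Int.cast_add, Int.cast_one]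
      congr 1
      field_simp
      ring
    · intro j _ hji
      simp [Pi.single_eq_of_ne hji]
    · simp
  refine ⟨fun i => (N : 𝕜)⁻¹ • D (e i), fun x => lam x - ℓ x, ?_, ?_, ?_⟩
  · intro x a
    have := hℓper x a
    rw [sub_eq_iff_eq_add'] at this
    show lam (x + (N : ℤ) • a) - ℓ (x + (N : ℤ) • a) = lam x - ℓ x
    rw [key a x, this]; abel
  · funext x i
    have h1 : d₀ (fun x => lam x - ℓ x) = d₀ lam - d₀ ℓ := d₀_sub lam ℓ
    rw [Pi.add_apply, Pi.add_apply, h1, Pi.sub_apply, Pi.sub_apply, hℓd, ← hlam]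
    abel
  · intro i
    show (N : 𝕜)⁻¹ • D (e i) = _
    congr 1
    rw [hDapply, ← zero_add ((N : ℤ) • e i), sub_eq_sum_d₀ lam 0 i N, hlam]
    simp

/-- For a non-trivial character the `χ`-Bloch primitive is UNIQUE: two `χ`-Bloch `0`-cochains with the
same coboundary coincide (their difference is a constant `c` with `c = χ a₀ • c`). [folklore] -/
theorem IsBloch.eq_of_d₀_eq {N : ℕ} {χ : Site d → 𝕜} {lam₁ lam₂ : Site d → V}
    (h₁ : IsBloch N χ lam₁) (h₂ : IsBloch N χ lam₂)
    (hd : LatticeForm.d₀ lam₁ = LatticeForm.d₀ lam₂) {a₀ : Site d} (h₀ : χ a₀ ≠ 1) :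
    lam₁ = lam₂ := by
  have hc : ∀ x, lam₁ x - lam₂ x = lam₁ 0 - lam₂ 0 := primitive_unique hd
  have hper : lam₁ 0 - lam₂ 0 = χ a₀ • (lam₁ 0 - lam₂ 0) := by
    have h3 := hc (0 + (N : ℤ) • a₀)
    rw [h₁ 0 a₀, h₂ 0 a₀, ← smul_sub] at h3
    exact h3.symm
  have hzero : lam₁ 0 - lam₂ 0 = 0 := by
    have : (1 - χ a₀) • (lam₁ 0 - lam₂ 0) = 0 := by
      rw [sub_smul, one_smul, ← hper, sub_self]
    rcases smul_eq_zero.1 this with h | h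
    · exact absurd (sub_eq_zero.1 h).symm h₀
    · exact h
  funext x
  rw [← sub_eq_zero, hc x, hzero]

end Field

/-! ### The nearest-neighbour Laplacian and the maximum principle for Bloch-periodic harmonic functions -/

section Harmonic

/-- The nearest-neighbour lattice Laplacian `(Δu)(x) = ∑ᵢ (u(x+eᵢ) + u(x-eᵢ) - 2u(x))`. [folklore] -/
def lap (u : Site d → A) (x : Site d) : A := ∑ i : Fin d, (u (x + e i) + u (x - e i) - 2 • u x)

/-- `Δu(x) = 0` says: the sum of the `2d` neighbour values is `2d` times the centre value. [folklore] -/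
theorem sum_nbrs_eq_of_lap_eq_zero {u : Site d → A} {x : Site d} (h : lap u x = 0) :
    ∑ i : Fin d, (u (x + e i) + u (x - e i)) = (2 * d) • u x := by
  unfold lap at h
  rw [Finset.sum_sub_distrib, sub_eq_zero, Finset.sum_const, Finset.card_univ, Fintype.card_fin,
    smul_smul, mul_comm] at h
  exact h

/-- **Equality case of the triangle inequality, averaged form:** if finitely many complex numbers of
modulus `≤ ‖w‖` sum to `card • w`, they are all equal to `w`
(`∑ ‖z_k - w‖² = ∑ (‖z_k‖² - ‖w‖²) ≤ 0`). [folklore] -/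
theorem eq_of_norm_le_of_sum_eq_card_smul {ι : Type*} (s : Finset ι) (z : ι → ℂ) (w : ℂ)
    (hle : ∀ k ∈ s, ‖z k‖ ≤ ‖w‖) (hsum : ∑ k ∈ s, z k = s.card • w) :
    ∀ k ∈ s, z k = w := by
  have key : ∑ k ∈ s, Complex.normSq (z k - w) = ∑ k ∈ s, (Complex.normSq (z k) - Complex.normSq w) := by
    have h1 : ∀ k, Complex.normSq (z k - w)
        = Complex.normSq (z k) + Complex.normSq w - 2 * (z k * (starRingEnd ℂ) w).re :=
      fun k => Complex.normSq_sub _ _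
    simp_rw [h1]
    rw [Finset.sum_sub_distrib, Finset.sum_add_distrib, Finset.sum_const, ← Finset.mul_sum,
      ← Complex.re_sum, ← Finset.sum_mul, hsum, Finset.sum_sub_distrib, Finset.sum_const]
    have h2 : ((s.card • w) * (starRingEnd ℂ) w).re = s.card • Complex.normSq w := by
      rw [smul_mul_assoc, Complex.mul_conj, nsmul_eq_mul, nsmul_eq_mul, ← Complex.ofReal_natCast,
        ← Complex.ofReal_mul, Complex.ofReal_re]
    rw [h2]
    simp only [nsmul_eq_mul]
    ring
  have hterm : ∀ k ∈ s, Complex.normSq (z k) - Complex.normSq w ≤ 0 := by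
    intro k hk
    have := hle k hk
    rw [Complex.normSq_eq_norm_sq, Complex.normSq_eq_norm_sq, sub_nonpos]
    exact pow_le_pow_left₀ (norm_nonneg _) this 2
  have hle0 : ∑ k ∈ s, Complex.normSq (z k - w) ≤ 0 := by
    rw [key]; exact Finset.sum_nonpos hterm
  have hge0 : ∀ k ∈ s, 0 ≤ Complex.normSq (z k - w) := fun k _ => Complex.normSq_nonneg _
  have hzero := (Finset.sum_eq_zero_iff_of_nonneg hge0).1 (le_antisymm hle0 (Finset.sum_nonneg hge0))
  intro k hk
  have := hzero k hk
  rwa [Complex.normSq_eq_zero, sub_eq_zero] at this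

variable {N : ℕ} {χ : Site d → ℂ} {u : Site d → ℂ}

/-- For a unitary character the modulus of a Bloch function is `N`-periodic. [folklore] -/
theorem IsBloch.norm_add_period (hB : IsBloch N χ u) (hχ : ∀ a, ‖χ a‖ = 1) (x a : Site d) :
    ‖u (x + (N : ℤ) • a)‖ = ‖u x‖ := by
  rw [hB x a, norm_smul, hχ, one_mul]

/-- Reduction of a lattice point modulo `N` in every coordinate: `x = red N x + N • quo N x` with
`red N x ∈ [0, N)^d`. [folklore] -/
def red (N : ℕ) (x : Site d) : Site d := fun j => x j % (N : ℤ)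

/-- The block index of a lattice point: `quo N x = ⌊x / N⌋` coordinatewise. [folklore] -/
def quo (N : ℕ) (x : Site d) : Site d := fun j => x j / (N : ℤ)

/-- Euclidean division coordinatewise: `x = red N x + N • quo N x`. [folklore] -/
theorem red_add_smul_quo (N : ℕ) (x : Site d) : red N x + (N : ℤ) • quo N x = x := by
  funext j
  simp only [red, quo, Pi.add_apply, Pi.smul_apply, smul_eq_mul]
  rw [add_comm]
  exact Int.mul_ediv_add_emod (x j) N

/-- The fundamental box `[0, N)^d` as a finite set of lattice points. [folklore] -/
noncomputable def box (d N : ℕ) : Finset (Site d) := Fintype.piFinset fun _ : Fin d => Finset.Ico (0 : ℤ) N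

/-- The reduction lands in the fundamental box (for `N ≥ 1`). [folklore] -/
theorem red_mem_box (hN : 0 < N) (x : Site d) : red N x ∈ box d N := by
  rw [box, Fintype.mem_piFinset]
  intro j
  rw [Finset.mem_Ico]
  have hN' : (0 : ℤ) < N := by exact_mod_cast hN
  exact ⟨Int.emod_nonneg _ hN'.ne', Int.emod_lt_of_pos _ hN'⟩

/-- The origin lies in the fundamental box (for `N ≥ 1`). [folklore] -/
theorem zero_mem_box (hN : 0 < N) : (0 : Site d) ∈ box d N := by
  rw [box, Fintype.mem_piFinset]
  intro j
  rw [Finset.mem_Ico, Pi.zero_apply]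
  exact ⟨le_rfl, by exact_mod_cast hN⟩

/-- A Bloch function with unitary character attains the maximum of its modulus (the modulus is
periodic, so it suffices to look at the fundamental box). [folklore] -/
theorem IsBloch.exists_norm_le (hN : 0 < N) (hB : IsBloch N χ u) (hχ : ∀ a, ‖χ a‖ = 1) :
    ∃ x₀ : Site d, ∀ x, ‖u x‖ ≤ ‖u x₀‖ := by
  obtain ⟨x₀, -, hmax⟩ :=
    Finset.exists_max_image (box d N) (fun x => ‖u x‖) ⟨0, zero_mem_box hN⟩
  refine ⟨x₀, fun x => ?_⟩
  have h1 : ‖u x‖ = ‖u (red N x)‖ := by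
    conv_lhs => rw [← red_add_smul_quo N x]
    exact hB.norm_add_period hχ _ _
  rw [h1]
  exact hmax _ (red_mem_box hN x)

/-- **Propagation step of the maximum principle:** at a point where a harmonic `u` takes the value `w`
of maximal modulus, all `2d` neighbours take the same value. [folklore] -/
theorem nbrs_eq_of_lap_eq_zero_of_max {w : ℂ} (hmax : ∀ y, ‖u y‖ ≤ ‖w‖) {x : Site d}
    (hx : u x = w) (hh : lap u x = 0) (i : Fin d) : u (x + e i) = w ∧ u (x - e i) = w := by
  have hs := sum_nbrs_eq_of_lap_eq_zero hh
  rw [hx] at hs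
  set z : Bool × Fin d → ℂ := fun p => if p.1 then u (x + e p.2) else u (x - e p.2) with hz
  have hzsum : ∑ p ∈ (Finset.univ : Finset (Bool × Fin d)), z p = (Finset.univ : Finset (Bool × Fin d)).card • w := by
    rw [Finset.card_univ, Fintype.card_prod, Fintype.card_bool, Fintype.card_fin, ← hs,
      Fintype.sum_prod_type, Fintype.sum_bool]
    simp only [hz, if_true, Bool.false_eq_true, if_false, ← Finset.sum_add_distrib]
  have hall := eq_of_norm_le_of_sum_eq_card_smul Finset.univ z w
    (fun p _ => by simp only [hz]; split <;> exact hmax _) hzsum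
  exact ⟨by simpa [hz] using hall (true, i) (Finset.mem_univ _),
    by simpa [hz] using hall (false, i) (Finset.mem_univ _)⟩

/-- `ℓ¹`-size of a lattice vector, for the connectedness induction. [folklore] -/
def l1 (v : Site d) : ℕ := ∑ j : Fin d, (v j).natAbs

/-- `‖v‖₁ = 0 ↔ v = 0`. [folklore] -/
theorem l1_eq_zero_iff (v : Site d) : l1 v = 0 ↔ v = 0 := by
  constructor
  · intro h
    funext j
    have := (Finset.sum_eq_zero_iff.1 h) j (Finset.mem_univ _)
    simpa using this
  · rintro rfl; simp [l1]

/-- **Connectedness of `ℤ^d` by unit steps:** a property stable under `x ↦ x ± eᵢ` holds everywhere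
once it holds at one point. [folklore] -/
theorem forall_of_step {P : Site d → Prop} {x₀ : Site d} (h0 : P x₀)
    (hstep : ∀ x, P x → ∀ i, P (x + e i) ∧ P (x - e i)) : ∀ x, P x := by
  suffices H : ∀ n : ℕ, ∀ v : Site d, l1 v = n → P (x₀ + v) by
    intro x
    have := H (l1 (x - x₀)) (x - x₀) rfl
    rwa [add_sub_cancel] at this
  intro n
  induction n with
  | zero =>
    intro v hv
    rw [(l1_eq_zero_iff v).1 hv, add_zero]; exact h0
  | succ n ih =>
    intro v hv
    -- pick a coordinate `j` with `v j ≠ 0`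
    have hne : v ≠ 0 := by
      intro h; rw [h] at hv; simp [l1] at hv
    obtain ⟨j, hj⟩ : ∃ j, v j ≠ 0 := by
      by_contra hcon
      exact hne (funext fun j => by by_contra h; exact hcon ⟨j, h⟩)
    -- step back towards the origin along `eⱼ`
    have hsplit : ∀ g : Fin d → ℕ, ∑ i, g i = g j + ∑ i ∈ Finset.univ.erase j, g i :=
      fun g => (Finset.add_sum_erase _ _ (Finset.mem_univ j)).symm
    rcases lt_or_gt_of_ne hj with hneg | hpos
    · -- `v j < 0`: `v = v' - eⱼ` with `l1 v' = n`
      set v' := v + e j with hv'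
      have hl : l1 v' = n := by
        have h1 := hsplit (fun i => (v i).natAbs)
        have h2 := hsplit (fun i => (v' i).natAbs)
        have h3 : ∑ i ∈ Finset.univ.erase j, (v' i).natAbs = ∑ i ∈ Finset.univ.erase j, (v i).natAbs := by
          apply Finset.sum_congr rfl
          intro i hi
          rw [hv', add_single_apply_of_ne v (Finset.ne_of_mem_erase hi)]
        have h4 : (v' j).natAbs + 1 = (v j).natAbs := by
          rw [hv', add_single_apply_self]; omega
        unfold l1 at hv ⊢
        omega
      have := (hstep _ (ih v' hl) j).2
      rwa [hv', add_sub_assoc, add_sub_cancel_right] at this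
    · -- `v j > 0`: `v = v' + eⱼ`
      set v' := v - e j with hv'
      have hl : l1 v' = n := by
        have h1 := hsplit (fun i => (v i).natAbs)
        have h2 := hsplit (fun i => (v' i).natAbs)
        have h3 : ∑ i ∈ Finset.univ.erase j, (v' i).natAbs = ∑ i ∈ Finset.univ.erase j, (v i).natAbs := by
          apply Finset.sum_congr rfl
          intro i hi
          rw [hv', sub_eq_add_neg, ← Pi.single_neg, add_single_apply_of_ne v (Finset.ne_of_mem_erase hi)]
        have h4 : (v' j).natAbs + 1 = (v j).natAbs := by
          rw [hv', sub_eq_add_neg, ← Pi.single_neg, add_single_apply_self]; omega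
        unfold l1 at hv ⊢
        omega
      have := (hstep _ (ih v' hl) j).1
      rwa [hv', add_assoc, sub_add_cancel] at this

/-- **Maximum principle (Bloch form):** a `χ`-Bloch discrete-harmonic function `u : ℤ^d → ℂ` with a
UNITARY character `χ` (`‖χ a‖ = 1`) is constant. [folklore] -/
theorem IsBloch.apply_eq_of_lap_eq_zero (hN : 0 < N) (hB : IsBloch N χ u) (hχ : ∀ a, ‖χ a‖ = 1)
    (hh : ∀ x, lap u x = 0) (x y : Site d) : u x = u y := by
  obtain ⟨x₀, hmax⟩ := hB.exists_norm_le hN hχ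
  have hall : ∀ x, u x = u x₀ :=
    forall_of_step (P := fun x => u x = u x₀) rfl
      (fun x hx i => nbrs_eq_of_lap_eq_zero_of_max hmax hx (hh x) i)
  rw [hall x, hall y]

/-- **Maximum principle, non-trivial character:** if moreover `χ a₀ ≠ 1` for some `a₀` (a non-zero
quasimomentum), the function vanishes identically — there are no non-zero Bloch waves of non-zero
quasimomentum in the kernel of the lattice Laplacian. [folklore] -/
theorem IsBloch.eq_zero_of_lap_eq_zero (hN : 0 < N) (hB : IsBloch N χ u) (hχ : ∀ a, ‖χ a‖ = 1)
    (hh : ∀ x, lap u x = 0) {a₀ : Site d} (h₀ : χ a₀ ≠ 1) : u = 0 := by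
  have hc := hB.apply_eq_of_lap_eq_zero hN hχ hh
  have h1 : (χ a₀ - 1) * u 0 = 0 := by
    have := hB 0 a₀
    rw [hc (0 + (N : ℤ) • a₀) 0, smul_eq_mul] at this
    rw [sub_mul, one_mul, ← this, sub_self]
  have h2 : u 0 = 0 := by
    rcases mul_eq_zero.1 h1 with h | h
    · exact absurd (sub_eq_zero.1 h) h₀
    · exact h
  funext x
  rw [Pi.zero_apply, hc x 0, h2]

/-- **Liouville for periodic discrete-harmonic functions:** an `N`-periodic (`N ≥ 1`) function on
`ℤ^d` in the kernel of the lattice Laplacian is constant. [folklore] -/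
theorem apply_eq_of_periodic_of_lap_eq_zero (hN : 0 < N) (hper : ∀ x a : Site d, u (x + (N : ℤ) • a) = u x)
    (hh : ∀ x, lap u x = 0) (x y : Site d) : u x = u y :=
  IsBloch.apply_eq_of_lap_eq_zero (χ := fun _ => 1) hN (fun x a => by rw [one_smul]; exact hper x a)
    (fun _ => by simp) hh x y

end Harmonic

/-! ### Torus form: closed `1`-cochains on the discrete torus `(ℤ/Nℤ)^d` are constant plus exact

The `N`-periodic statements above, transported to functions on `TorusSite d N = Fin d → ZMod N` along the
projection `Torus.proj N : ℤ^d → (ℤ/Nℤ)^d` (pull back, apply `exists_const_add_d₀_of_periodic`, push the periodic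
primitive down through integer representatives). Closedness is stated by the explicit plaquette formula, so that
this file needs no torus-coboundary import (`LatticeForm.td₁` of `AbelianTorusCochains.lean` unfolds to it). -/

section Torus

open Literature.Probability.LatticeModels (TorusSite Torus.proj Torus.proj_apply)

variable {N : ℕ}

/-- The coboundary of a `0`-cochain on the discrete torus: `td₀ μ (y, i) = μ (y + eᵢ) - μ y`. [folklore] -/
def td₀ (μ : TorusSite d N → A) : TorusSite d N → Fin d → A :=
  fun y i => μ (y + Pi.single i 1) - μ y

/-- Integer representatives of a torus point (coordinatewise `ZMod.val`). [folklore] -/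
def repZ (y : TorusSite d N) : Site d := fun j => ((y j).val : ℤ)

/-- `Torus.proj ∘ repZ = id`. [folklore] -/
theorem proj_repZ [NeZero N] (y : TorusSite d N) : Torus.proj N (repZ y) = y := by
  funext j
  simp [repZ, Torus.proj_apply]

/-- The projection does not see translations by the sublattice `N•ℤ^d`. [folklore] -/
theorem proj_add_zsmul (x a : Site d) : Torus.proj N (x + (N : ℤ) • a) = Torus.proj N x := by
  funext j
  simp [Torus.proj_apply]

/-- The projection intertwines the unit translations. [folklore] -/
theorem proj_add_e (x : Site d) (i : Fin d) :
    Torus.proj N (x + e i) = Torus.proj N x + Pi.single i 1 := by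
  funext j
  by_cases hj : j = i
  · subst hj; simp [Torus.proj_apply]
  · simp [Torus.proj_apply, Pi.single_eq_of_ne hj]

/-- Two lattice points with the same projection differ by an element of `N•ℤ^d`. [folklore] -/
theorem exists_eq_add_zsmul_of_proj_eq {x x' : Site d} (h : Torus.proj N x = Torus.proj N x') :
    ∃ a : Site d, x' = x + (N : ℤ) • a := by
  have hd : ∀ j, (N : ℤ) ∣ x' j - x j := by
    intro j
    have := congrFun h j
    simp only [Torus.proj_apply] at this
    exact (ZMod.intCast_eq_intCast_iff_dvd_sub _ _ _).1 this
  choose a ha using hd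
  refine ⟨a, funext fun j => ?_⟩
  have := ha j
  simp only [Pi.add_apply, Pi.smul_apply, smul_eq_mul]
  linarith

/-- **`H¹` of the discrete torus `(ℤ/Nℤ)^d` is spanned by the constant `1`-cochains:** a `1`-cochain `θ` on
`TorusSite d N` with vanishing plaquette sums (`θ(y,i) + θ(y+eᵢ,j) - θ(y+eⱼ,i) - θ(y,j) = 0`, i.e. `td₁ θ = 0`) is a
CONSTANT plus the coboundary of a `0`-cochain, `θ = c + td₀ μ`, with `c i = N⁻¹ • ∑_{t<N} θ(t eᵢ; i)` the cycle
average; over any field in which `N ≠ 0`. (This is the hypothesis (Hdg) of the one-block-torus uniqueness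
`Beta.TorusKKTUniqueness.torus_uniqueness`, for the concrete torus.) [folklore] -/
theorem exists_const_add_td₀ {𝕜 : Type*} [Field 𝕜] {V : Type*} [AddCommGroup V] [Module 𝕜 V]
    [NeZero N] (hN : (N : 𝕜) ≠ 0) (θ : TorusSite d N → Fin d → V)
    (hcl : ∀ (y : TorusSite d N) (i j : Fin d),
      θ y i + θ (y + Pi.single i 1) j - θ (y + Pi.single j 1) i - θ y j = 0) :
    ∃ (c : Fin d → V) (μ : TorusSite d N → V), θ = (fun _ => c) + td₀ μ ∧
      ∀ i, c i = (N : 𝕜)⁻¹ • ∑ t ∈ Finset.range N, θ (Torus.proj N ((t : ℤ) • e i)) i := by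
  -- pull back to an `N`-periodic closed cochain on `ℤ^d`
  set Θ : Site d → Fin d → V := fun x => θ (Torus.proj N x) with hΘ
  have hper : ∀ x a : Site d, Θ (x + (N : ℤ) • a) = Θ x := by
    intro x a; simp only [hΘ, proj_add_zsmul]
  have hclZ : d₁ Θ = 0 := by
    funext x i j
    simp only [d₁, hΘ, proj_add_e, Pi.zero_apply]
    exact hcl _ i j
  obtain ⟨c, μZ, hμper, hdec, hc⟩ := exists_const_add_d₀_of_periodic hN hper hclZ
  refine ⟨c, fun y => μZ (repZ y), ?_, ?_⟩
  · funext y i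
    -- `θ y i = Θ (repZ y) i = c i + μZ (repZ y + eᵢ) - μZ (repZ y)`
    have h1 : θ y i = Θ (repZ y) i := by simp only [hΘ, proj_repZ]
    have h2 := congrFun (congrFun hdec (repZ y)) i
    simp only [Pi.add_apply, d₀] at h2
    -- the two lifts of `y + eᵢ` differ by a period
    have h3 : Torus.proj N (repZ y + e i) = Torus.proj N (repZ (y + Pi.single i 1)) := by
      rw [proj_add_e, proj_repZ, proj_repZ]
    obtain ⟨a, ha⟩ := exists_eq_add_zsmul_of_proj_eq h3
    have h4 : μZ (repZ (y + Pi.single i 1)) = μZ (repZ y + e i) := by rw [ha, hμper]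
    simp only [Pi.add_apply, td₀]
    rw [h1, h2, h4]
  · intro i
    rw [hc i]

/-- **The same `H¹` statement for uncurried, direction-first indexed cochains** `D : Fin d × (Fin d → ZMod N) → V`
(the indexing of `Beta.OneBlockTorusKKT`: `d1 D ((κ,l),x) = D (κ,x) + D (l, x + e κ) − D (κ, x + e l) − D (l,x)`,
`d0 μ (κ,x) = μ (x + e κ) − μ x`, `const c (κ,x) = c κ`): vanishing plaquette sums ⇒ `D = const c + d0 μ` pointwise.
The `EuclideanSpace ℝ _` form used there is this statement read through `WithLp.equiv`. [folklore] -/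
theorem exists_const_add_grad_prod {𝕜 : Type*} [Field 𝕜] {V : Type*} [AddCommGroup V] [Module 𝕜 V]
    [NeZero N] (hN : (N : 𝕜) ≠ 0) (D : Fin d × TorusSite d N → V)
    (hcl : ∀ (κ l : Fin d) (x : TorusSite d N),
      D (κ, x) + D (l, x + Pi.single κ 1) - D (κ, x + Pi.single l 1) - D (l, x) = 0) :
    ∃ (c : Fin d → V) (μ : TorusSite d N → V),
      ∀ (κ : Fin d) (x : TorusSite d N), D (κ, x) = c κ + (μ (x + Pi.single κ 1) - μ x) := by
  obtain ⟨c, μ, hdec, -⟩ :=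
    exists_const_add_td₀ (𝕜 := 𝕜) hN (fun y i => D (i, y)) (fun y i j => hcl i j y)
  refine ⟨c, μ, fun κ x => ?_⟩
  have := congrFun (congrFun hdec x) κ
  simpa [td₀] using this

end Torus

end LatticeForm

end Literature.MathematicalPhysics.QuantumFieldTheory
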